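import Literature.Geometry.DiscreteGeometry.HeitmannRadinStructure
import HarnessLib

/-!
# Heitmann–Radin 1980, Theorem (2)(b): a ground state of `n` sticky discs has exactly `⌈√(12n-3)⌉ - 3` boundary discs

Topic `Literature/Geometry/DiscreteGeometry`; sequel to `HeitmannRadinStructure.lean`. Heitmann–Radin
[HeitmannRadin1980, Theorem (2)(b), p. 284]: "For any maximal configuration `C` of `n` disks,
`n ≥ 3`: […] (b) `C_g` contains exactly `-[3 - (12n - 3)^{1/2}]` boundary vertices", where
(p. 284) `a`, "the number of boundary vertices", is "the cardinality of `C_v ∩ ∂C_g`", `∂C_g`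
being the simple closed boundary polygon of the drawing, and `-[3 - x] = ⌈x⌉ - 3`. Printed proof
(p. 286): "And since now (4) [`C_b ≤ 3n - a - 3`] is seen to be an equality, part (2b) of the
Theorem is also proven" — i.e. `a = 3n - 3 - B(n) = 3n - 3 - [3n - √(12n-3)] = ⌈√(12n-3)⌉ - 3`.

Rendering: the boundary polygon is the tree's boundary walk `Harborth.bdry` of the (non-splitting,
`not_splits_of_maximal`) configuration, a simple closed polygon (`isSimplePolygon_bdry`) whose
vertex set is `Harborth.bdrySet` with `a = period` vertices (`card_bdrySet`); we prove
`#bdrySet = ⌈√(12n - 3)⌉ - 3`. The equality in (4) is obtained, as printed, from the structure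
theorem `tight_or_outer_of_maximal` (every corner tight or outer): an interior disc then has
exactly six neighbours and a boundary disc of degree `j` has interior angle exactly `(j-1)π/3`,
so `2 C_b = ∑ deg = (4a - 6) + 6(n - a)`, i.e. `C_b = 3n - a - 3`; with `C_b = [3n - √(12n-3)]`
(Harborth) this is (2)(b).
-/

noncomputable section

namespace Literature.Geometry.DiscreteGeometry

namespace Harborth

open Complex Finset
open Literature.Topology.PlaneTopology
open scoped Real

variable {P : Finset ℂ}

/-- **All other corners tight ⇒ the remaining corner is determined**: if every corner at `p`
except possibly the one after `q` is tight, then `gapAngle P q p + (deg p - 1) π/3 = 2π` exactly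
(equality in Harborth's (2) at that vertex). [cite: HeitmannRadin1980, (6)] -/
theorem gapAngle_add_eq_of_tight {p q : ℂ} (hq : q ∈ nbrs P p) (h2 : 2 ≤ (nbrs P p).card)
    (ht : ∀ k ∈ nbrs P p, k ≠ q → gapAngle P k p = π / 3) :
    gapAngle P q p + (((nbrs P p).card : ℝ) - 1) * (π / 3) = 2 * π := by
  classical
  have hsum := sum_gapAngle (P := P) (p := p) h2
  rw [← Finset.add_sum_erase _ _ hq] at hsum
  have hrest : ∑ k ∈ (nbrs P p).erase q, gapAngle P k p = ∑ _k ∈ (nbrs P p).erase q, (π / 3) :=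
    Finset.sum_congr rfl fun k hk =>
      ht k (Finset.mem_of_mem_erase hk) (Finset.ne_of_mem_erase hk)
  rw [hrest, Finset.sum_const, Finset.card_erase_of_mem hq, nsmul_eq_mul,
    Nat.cast_sub (by omega : 1 ≤ (nbrs P p).card)] at hsum
  push_cast at hsum
  linarith

section Count

variable {hne : P.Nonempty} {h2 : ∀ p ∈ P, 2 ≤ (nbrs P p).card}

/-- **Equality in Harborth's (2)**: if every corner is tight or outer (and the configuration does
not split), the boundary degrees sum to exactly `4a - 6` — every interior angle of the boundary
polygon at a vertex of degree `j` is exactly `(j-1)π/3`. [cite: HeitmannRadin1980, p. 286] -/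
theorem sum_card_nbrs_bdrySet_eq_of_tight (hP : IsHard P) (hns : ¬ Splits P)
    (ht : ∀ d ∈ darts P, gapAngle P d.1 d.2 = π / 3 ∨ d ∈ Set.range (traceDart P hne h2)) :
    (∑ v ∈ bdrySet P hne h2, ((nbrs P v).card : ℤ)) + 6 = 4 * (bdrySet P hne h2).card := by
  have hπ := Real.pi_pos
  set T := period P hne h2 with hT
  have hsum := sum_extAngle_bdry (hne := hne) (h2 := h2) hP hns
  -- at each boundary vertex: `(deg - 1) π/3 = π - ext`
  have hloc : ∀ m ∈ Finset.range T,
      (((nbrs P (bdry P hne h2 m)).card : ℝ) - 1) * (π / 3) = π - extAngle (bdry P hne h2) m := by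
    intro m hm
    have hm' : m < T := Finset.mem_range.1 hm
    have hq : bdry P hne h2 ((m : ℤ) - 1) ∈ nbrs P (bdry P hne h2 m) :=
      bdry_pred_mem_nbrs (hne := hne) (h2 := h2) (m : ℤ)
    have htight : ∀ k ∈ nbrs P (bdry P hne h2 m), k ≠ bdry P hne h2 ((m : ℤ) - 1) →
        gapAngle P k (bdry P hne h2 m) = π / 3 := by
      intro k hk hkq
      rcases ht (k, bdry P hne h2 m) (mk_mem_darts (mem_nbrs.1 hk).1
        (mem_nbrs.2 ⟨bdry_mem _, by rw [norm_sub_rev]; exact (mem_nbrs.1 hk).2⟩)) with h | ⟨i, hi⟩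
      · exact h
      · -- an outer corner at `bdry m` is the one after `bdry (m - 1)`
        exfalso
        rw [traceDart_eq_bdry] at hi
        obtain ⟨hi1, hi2⟩ := Prod.mk.inj hi
        have hmod := emod_eq_of_bdry_eq hP hns hi2
        apply hkq
        rw [← hi1]
        apply bdry_eq_of_emod_eq
        have e : (i : ℤ) = ((i : ℤ) + 1) - 1 := by ring
        rw [e, Int.sub_emod, hmod, ← Int.sub_emod]
    have := gapAngle_add_eq_of_tight hq (h2 _ (bdry_mem _)) htight
    rw [gapAngle_bdry hP hns] at this
    linarith
  have hall := Finset.sum_congr rfl hloc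
  rw [← Finset.sum_mul, Finset.sum_sub_distrib, Finset.sum_sub_distrib, hsum] at hall
  simp only [Finset.sum_const, Finset.card_range, nsmul_eq_mul, mul_one] at hall
  have hreal : (∑ m ∈ Finset.range T, ((nbrs P (bdry P hne h2 m)).card : ℝ)) = 4 * T - 6 := by
    nlinarith
  -- transfer to the boundary set
  have hinj : Set.InjOn (fun m : ℕ => bdry P hne h2 m) (Finset.range T : Set ℕ) :=
    fun a ha b hb h => bdry_injOn hP hns (Finset.mem_range.1 (Finset.mem_coe.1 ha))
      (Finset.mem_range.1 (Finset.mem_coe.1 hb)) h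
  rw [card_bdrySet hP hns, bdrySet, Finset.sum_image hinj]
  have e : ((∑ m ∈ Finset.range T, ((nbrs P (bdry P hne h2 m)).card : ℤ) : ℤ) : ℝ) =
      ∑ m ∈ Finset.range T, ((nbrs P (bdry P hne h2 m)).card : ℝ) := by
    push_cast; rfl
  have h' : ((∑ m ∈ Finset.range T, ((nbrs P (bdry P hne h2 m)).card : ℤ) : ℤ) : ℝ) =
      ((4 * T - 6 : ℤ) : ℝ) := by
    rw [e]; push_cast; exact hreal
  have := (Int.cast_inj (α := ℝ)).1 h'
  rw [← hT]
  omega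

/-- **An interior disc of a tight-or-outer configuration has exactly six neighbours** (all its
corners are tight, and they sum to `2π`). [cite: HeitmannRadin1980, p. 286] -/
theorem card_nbrs_eq_six_of_tight (hP : IsHard P)
    (ht : ∀ d ∈ darts P, gapAngle P d.1 d.2 = π / 3 ∨ d ∈ Set.range (traceDart P hne h2))
    {v : ℂ} (hv : v ∈ P) (hvS : v ∉ bdrySet P hne h2) : (nbrs P v).card = 6 := by
  have hπ := Real.pi_pos
  have h2v := h2 v hv
  obtain ⟨q, hq⟩ : (nbrs P v).Nonempty := Finset.card_pos.1 (by omega)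
  have htight : ∀ k ∈ nbrs P v, gapAngle P k v = π / 3 := by
    intro k hk
    rcases ht (k, v) (mk_mem_darts (mem_nbrs.1 hk).1
      (mem_nbrs.2 ⟨hv, by rw [norm_sub_rev]; exact (mem_nbrs.1 hk).2⟩)) with h | ⟨i, hi⟩
    · exact h
    · exfalso
      apply hvS
      rw [traceDart_eq_bdry] at hi
      rw [← (Prod.mk.inj hi).2]
      exact bdry_mem_bdrySet _
  have := gapAngle_add_eq_of_tight hq h2v (fun k hk _ => htight k hk)
  rw [htight q hq] at this
  have hle := card_nbrs_le_six hP v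
  have h6 : ((nbrs P v).card : ℝ) = 6 := by nlinarith
  exact_mod_cast h6

/-- **Heitmann–Radin 1980, Theorem (2)(b).** A maximal configuration of `n ≥ 3` unit discs has
exactly `⌈√(12n - 3)⌉ - 3` (`= -[3 - (12n - 3)^{1/2}]`) boundary discs, i.e. vertices of its
boundary polygon `bdry` (the simple closed polygon of `isSimplePolygon_bdry`, vertex set
`bdrySet`). As printed: equality in (4), `C_b = 3n - a - 3`, together with `C_b = [3n - √(12n-3)]`.
[cite: HeitmannRadin1980, Theorem (2)(b)] -/
theorem card_bdrySet_of_maximal (hP : IsHard P) (h3 : 3 ≤ P.card)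
    (hmax : 2 * harborthNumber P.card ≤ ((darts P).card : ℤ)) :
    ((bdrySet P hne h2).card : ℤ) = ⌈Real.sqrt (12 * P.card - 3)⌉ - 3 := by
  classical
  have hns : ¬ Splits P := not_splits_of_maximal hP hmax
  have ht := tight_or_outer_of_maximal P.card P hP rfl h3 hmax hne h2
  set S := bdrySet P hne h2 with hS
  have hSP : S ⊆ P := bdrySet_subset
  have haP : S.card ≤ P.card := Finset.card_le_card hSP
  -- `∑_∂ deg = 4a - 6` and `∑_interior deg = 6(n - a)`
  have hbd := sum_card_nbrs_bdrySet_eq_of_tight (hne := hne) (h2 := h2) hP hns ht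
  rw [← hS] at hbd
  have hint : ∑ v ∈ P \ S, (nbrs P v).card = 6 * (P.card - S.card) := by
    rw [← Finset.card_sdiff_of_subset hSP, mul_comm]
    refine Finset.sum_const_nat fun v hv => ?_
    exact card_nbrs_eq_six_of_tight (hne := hne) (h2 := h2) hP ht (Finset.mem_sdiff.1 hv).1
      (Finset.mem_sdiff.1 hv).2
  -- `2 C_b = ∑ deg`
  have hsplit : ((darts P).card : ℤ) = (∑ v ∈ S, ((nbrs P v).card : ℤ)) +
      ((∑ v ∈ P \ S, (nbrs P v).card : ℕ) : ℤ) := by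
    rw [card_darts_eq_sum, ← Finset.sum_sdiff hSP]; push_cast; ring
  rw [hint, Nat.cast_mul, Nat.cast_sub haP] at hsplit
  -- `C_b = [3n - √(12n-3)]`
  have hD : ((darts P).card : ℤ) = 2 * harborthNumber P.card :=
    le_antisymm (card_darts_le P hP) hmax
  rw [harborthNumber_eq_sub_ceil] at hD
  push_cast at hsplit
  linarith

end Count

end Harborth

end Literature.Geometry.DiscreteGeometry

end
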